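import Summits.QuantumFields.BalabanUV.T4Continuum.Support.ShellMeasureLandauPinnedKernels

/-!
# `T4Continuum.ShellMeasureLandauPinnedFieldRadius` — row S112 f1 «THE PINNED CONTRACTION BUDGET IN PRINT's (53)–(54) SHAPE»:
# S81's two pinned Lipschitz constants RE-DERIVED BY CAUCHY AT THE FIELD RADIUS (B11 (120)'s mechanism) instead of the
# analyticity radius — `L_C = 4C₂ρ_C·e^{δ′r_C}` (`2ρ_C ≤ R`), `L_W = 4C₄ρ_W·e^{δ′r_W}` (`2ρ_W ≤ a₃`) — and S70 (iv)'s `z_pin`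
# with the two contraction numbers in the FIELD-SIZE shape `q_W♯ = B_𝒢p·4C₄(ε₄+B₀b)e^{δ′r_W}`, `k♯ = 12C₂(ε₄+B₀b)e^{δ′r_C}·c_ι·B_H`
(cell `pub-balaban`, sub-cell `t4`, spine estimate NE7c (node U5b); NE7c ROUND-2 crew, unit `b2b-balaban-t4-ne7c-formalise-leaf-07`
gen 10 — the S81 author lineage; owner table row **S112** (RULING R-ne7cp1-g36-14 (a)(ii) on FINDING F-ne7cleaf06g9-1 (leaf-06-g9)
and NOTE N-ne7cleaf02g12-3 (leaf-02-g12)); ADDITIVE — imports S81 f2 `ShellMeasureLandauPinnedKernels` (p227859; hence S81 f1, S70 f2)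
ONLY; touches NO host; [folklore]; 0 `def`, 0 `def … : Prop`, 0 sorry, 0 citation tags)

HONEST FRAMING.  Finite four-torus programme, rung (B)+1 only — NOT infinite volume, NOT a mass gap, NOT the Clay problem, NOT summit
progress; (B), `BetaPertHyp`, (B^μ) not consumed.  NE7c (`T4IndicatorShell.ShellWeightBound`) is NOT PRINTED in [Balaban 1983–89] and NOT
PROVED; «NE7c ⇐ the named binders» (trigger c3).  ELEMENTARY complex analysis on OUR typed objects (Cauchy's estimate, the mean-value
inequality, S69's pinned norms); nothing printed is asserted, cited or discharged.  HONEST DEPENDENCY (cell): continuum YM on T⁴ ⇐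
BetaPertH ∧ nine spine estimates (0/9 proved); BetaPertH ⇐ (D1) ∧ (D4) ∧ CAP+tail; G-an2-4 gates asym, D1 and NE2/3/4.

THE FINDING THIS FILE ANSWERS (F-ne7cleaf06g9-1, ACCEPTED R-ne7cp1-g36-14).  S81 f1 `lipschitz_of_quadPair` bounds the derivative of a
quadratic∕analytic letter by Cauchy AT THE ANALYTICITY RADIUS `R` (`‖DC‖ ≤ C₂R²∕(R∕2) = 2C₂R` on the half ball), so the END hosts'
pinned contraction rows read `hqW : B_𝒢p·(2C₄a₃·e^{δ′r_W}) < 1` and `hk : 2C₂R_C·e^{δ′r_C}·c_ι·B_H < 1` — RADIUS-based; once S99 f3b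
instantiated `R_C := landauRad d L` (`2·C2cov d·landauRad d L = min(1, 12288(d+1)∕L)`) the row `hk` lost every field-size factor
and demands `c_H·M_H < e^{−δw·r_C}` for the designed restriction letter — NOT [Balaban1985Variational] p. 286 (53)–(54)'s shape
(«contractive if `9C₂B₀ε₃ < 1`» — FIELD-SIZE based), hence uninhabitable by designed letters (leaf-06 `not_hk_of_designed`).
THE REPAIR (leaf-02's spelling, the owner's row S112): Cauchy AT THE FIELD RADIUS — for `‖Z‖ < ρ` with `2ρ ≤ R` the ball of radius
`2ρ` about `0` carries `‖C‖ ≤ C₂(2ρ)²`, so `‖DC(Z)‖ ≤ 4C₂ρ²∕(2ρ − ‖Z‖) ≤ 4C₂ρ` (B11 (120)∕(158)'s mechanism, `B11Prop6Scheme.lipschitz_120`),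
and the chain's arguments have field size `ρ_C = 3(ε₄ + B₀b)` ((54): Sect. C's ball) ∕ `ρ_W = ε₄ + B₀b` ((121)): the SAME
displayed flat pairs give `L_C = 12C₂(ε₄+B₀b)e^{δ′r_C}`, `L_W = 4C₄(ε₄+B₀b)e^{δ′r_W}` — `hk♯ : 12·C₂·(ε₄ + B₀b)·e^{δ′r_C}·c_ι·B_H < 1`,
`hqW♯ : B_𝒢p·(4·C₄·(ε₄ + B₀b)·e^{δ′r_W}) < 1`, both FIELD-SIZE × pin factor × Schur products, as print's (53)–(54) ∕ (158).
THIS FILE (the lemma layer; the host re-fire = S112 f2, a new END root, post-v5 per R-ne7cp1-g36-14):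
* §1 **`lipschitz_of_quadPair_field`** — flat pair on `ball 0 R`, `2ρ ≤ R` ⟹ `‖C Z − C Z′‖ ≤ 4C₂ρ·‖Z − Z′‖` on `‖·‖ < ρ`;
* §2 **`hCp_of_local_field`** — S81 f1 §1 `norm_conj_sub_le_of_local` ∘ §1: `‖Cpin A − Cpin A′‖_pin ≤ 4C₂ρ·e^{δ′r₀}·‖A − A′‖_pin` on
  the flat ball `ρ` (located supports + reach, as there);
* §3 **`hWp_of_local_field`**, **`hGWp_of_local_field`** — the (P4) letter from its OWN `Prop4Hyp W C₄ a₃` on the flat ball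
  `ρ_W`, `2ρ_W ≤ a₃`: `L_W = 4C₄ρ_W·e^{δ′r_W}`, `q_W = B_𝒢p·L_W`;
* §4 **`norm_sub_landauField_chart_le_of_local_field`** — S81 f1 §5's junction with Sect. C RUN AT THE FIELD RADIUS `3(ε₄ + B₀b)`
  (S70 f2 `ShellMeasureLandauPinnedField.norm_sub_landauField_chart_le` BY NAME at `R := 3(ε₄+B₀b)`; the displayed `hRC : 6(ε₄+B₀b) ≤ R`
  is exactly `2ρ_C ≤ R`): `z_pin = B₁ₚbₚ∕((1 − B_𝒢p·L_W)(1 − 12C₂(ε₄+B₀b)e^{δ′r₀}·c_ι·B_H))` under **`hk♯`**;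
* §5 **`norm_sub_landauField_chart_le_of_kernels_field`** — S81 f2 §4's END (all five spaces flat pi-types, the four linear letters
  as `kerOp`s with pinned bounds, localities, block support) with BOTH budgets in the field-size shape: **`hqW♯`**, **`hk♯`**,
  `z_pin♯ = B₁ₚ·b∕((1 − B_𝒢p·(4C₄(ε₄+B₀b)e^{δ′r_W}))(1 − 12C₂(ε₄+B₀b)e^{δ′r_C}·c_ι·B_H))`; every other binder of S81 f2 §4 VERBATIM.
SIZE CHECK (why the new rows are inhabitable where the old `hk` was not): with `R_C := landauRad` and `6(ε₄+B₀b) ≤ landauRad` (`hRCw`),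
`12C₂(ε₄+B₀b) ≤ 2C₂·landauRad ≤ 1`, and the field size `ε₄ + B₀b` is as small as the coupling makes it — the factor print uses.
HONEST: OUR Lipschitz constants re-derived from the SAME displayed (44)∕(P4) pairs; the decay halves, the flat pairs, `hq`∕`hqw`∕`h18`
etc. REMAIN displayed; the census COUNT does not move (one `hk` row ↦ one `hk♯` row), its honesty does (R-g36-14 (a)(iv)); nothing of
Bałaban's asserted or discharged; NOTHING in the countdown moves; NE7c NOT PROVED; spine 0∕9.
-/

noncomputable section

open Set Metric

namespace Summit.QuantumFields.BalabanUV.T4Continuum.ShellMeasureLandauPinnedFieldRadius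

open Literature.MathematicalPhysics.QuantumFieldTheory.Balaban1983to89
open B11Prop6Scheme (Prop4Hyp)
open B8SectDSource (norm_fderiv_le_of_norm_le)
open Summit.QuantumFields.BalabanUV.T4Continuum.ShellMeasureMultiGridNorms (WSup)
open Summit.QuantumFields.BalabanUV.T4Continuum.ShellMeasureMultiGridNorms.WSup (toPiL toPiL_apply toPiL_symm_apply)
open Summit.QuantumFields.BalabanUV.T4Continuum.ShellMeasureDecayKernelSums (kerOp kerOp_apply)
open Summit.QuantumFields.BalabanUV.T4Continuum.ShellMeasurePinnedNorm (pinW pinW_apply kerOpPin)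
open Summit.QuantumFields.BalabanUV.T4Continuum.ShellMeasureLandauHolonomy (solAt landauExp)
open Summit.QuantumFields.BalabanUV.T4Continuum.ShellMeasureLandauPinnedField (norm_sub_landauField_chart_le)
open Summit.QuantumFields.BalabanUV.T4Continuum.ShellMeasureLandauPinnedLipschitz (norm_conj_sub_le_of_local
  hGWp_of_pinnedLipschitz)
open Summit.QuantumFields.BalabanUV.T4Continuum.ShellMeasureLandauPinnedKernels (norm_conj_kerOp_le hΦp_of_support)

/-! ## §1 Cauchy at the FIELD radius: the flat pair ⟹ Lipschitz `4C₂ρ` on the ball `ρ`, `2ρ ≤ R` -/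

section Cauchy

variable {E F : Type*} [NormedAddCommGroup E] [NormedSpace ℂ E] [NormedAddCommGroup F] [NormedSpace ℂ F]

/-- **THE FLAT QUADRATIC∕ANALYTIC PAIR ⟹ A FIELD-SIZE LIPSCHITZ CONSTANT** (B11 (120)'s mechanism): `‖C Z‖ ≤ C₂‖Z‖²` on `‖Z‖ < R`
(`0 ≤ C₂`), `DifferentiableOn ℂ C (ball 0 R)`, and `2ρ ≤ R` ⟹ `‖C Z − C Z′‖ ≤ 4C₂ρ·‖Z − Z′‖` for `‖Z‖, ‖Z′‖ < ρ`.  Proof: on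
`ball 0 (2ρ) ⊆ ball 0 R` the letter is bounded by `C₂(2ρ)²`; Cauchy's estimate (`B8SectDSource.norm_fderiv_le_of_norm_le`) gives
`‖DC(A)‖ ≤ 4C₂ρ²∕(2ρ − ‖A‖) ≤ 4C₂ρ` for `‖A‖ < ρ`; mean-value inequality on the convex ball `ρ`.  Compare S81 f1 `lipschitz_of_quadPair`
(`2C₂R` on the half ball: Cauchy at the ANALYTICITY radius). [folklore] -/
theorem lipschitz_of_quadPair_field {C : E → F} {C₂ R ρ : ℝ} (hC₂ : 0 ≤ C₂)
    (hCq : ∀ Z : E, ‖Z‖ < R → ‖C Z‖ ≤ C₂ * ‖Z‖ ^ 2) (hCd : DifferentiableOn ℂ C (ball 0 R)) (hρR : 2 * ρ ≤ R)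
    {Z Z' : E} (hZ : ‖Z‖ < ρ) (hZ' : ‖Z'‖ < ρ) :
    ‖C Z - C Z'‖ ≤ 4 * C₂ * ρ * ‖Z - Z'‖ := by
  have hρ : 0 < ρ := (norm_nonneg Z).trans_lt hZ
  have hsub2 : ball (0 : E) (2 * ρ) ⊆ ball 0 R := ball_subset_ball hρR
  have hCd2 : DifferentiableOn ℂ C (ball 0 (2 * ρ)) := hCd.mono hsub2
  have hb : ∀ A ∈ ball (0 : E) (2 * ρ), ‖C A‖ ≤ C₂ * (2 * ρ) ^ 2 := fun A hA => by
    have hA2 := mem_ball_zero_iff.1 hA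
    exact (hCq A (hA2.trans_le hρR)).trans
      (mul_le_mul_of_nonneg_left (pow_le_pow_left₀ (norm_nonneg A) hA2.le 2) hC₂)
  have hsub : ball (0 : E) ρ ⊆ ball 0 (2 * ρ) := ball_subset_ball (by linarith)
  have hD : ∀ A ∈ ball (0 : E) ρ, ‖fderiv ℂ C A‖ ≤ 4 * C₂ * ρ := fun A hA => by
    have hAn : ‖A‖ < ρ := mem_ball_zero_iff.1 hA
    refine (norm_fderiv_le_of_norm_le hCd2 hb (hAn.trans (by linarith))).trans ?_
    rw [div_le_iff₀ (by linarith)]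
    have h2 : ρ ≤ 2 * ρ - ‖A‖ := by linarith
    calc C₂ * (2 * ρ) ^ 2 = 4 * C₂ * ρ * ρ := by ring
      _ ≤ 4 * C₂ * ρ * (2 * ρ - ‖A‖) := mul_le_mul_of_nonneg_left h2 (by positivity)
  have hf : ∀ A ∈ ball (0 : E) ρ, HasFDerivWithinAt C (fderiv ℂ C A) (ball 0 ρ) A := fun A hA =>
    ((hCd2.mono hsub).differentiableAt (isOpen_ball.mem_nhds hA)).hasFDerivAt.hasFDerivWithinAt
  exact (convex_ball (0 : E) ρ).norm_image_sub_le_of_norm_hasFDerivWithin_le hf hD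
    (mem_ball_zero_iff.2 hZ') (mem_ball_zero_iff.2 hZ)

end Cauchy

/-! ## §2 `hCp` at the field radius (S81 f1 §1 ∘ §1) -/

section LocalPair

variable {Λ Λ' : Type*} [Fintype Λ] [Fintype Λ'] {𝔄 𝔅 : Type*} [NormedAddCommGroup 𝔄] [NormedSpace ℂ 𝔄]
  [NormedAddCommGroup 𝔅] [NormedSpace ℂ 𝔅]

/-- **`hCp` FROM LOCALITY AND THE FLAT PAIR, AT THE FIELD RADIUS**: a local letter `C : (Λ → 𝔄) → (Λ′ → 𝔅)` (located supports `N`,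
reach `r₀` against the pins `ϖ`, `ϖ′`, `δ′ ≥ 0`) with the flat pair on `ball 0 R` (`0 ≤ C₂`) and a field radius `0 < ρ`, `2ρ ≤ R`
satisfies, for all flat `‖A‖, ‖A′‖ < ρ`, `‖Cpin A − Cpin A′‖_pin ≤ (4C₂ρ·e^{δ′r₀})·‖A − A′‖_pin` — `ShellMeasureLandauPinnedField`'s
`hCp` on the flat ball `ρ` with **`L_C = 4C₂ρ·e^{δ′r₀}`** (S81 f1: `2C₂R·e^{δ′r₀}` on `R∕2`). [folklore] -/
theorem hCp_of_local_field {δ' : ℝ} (hδ' : 0 ≤ δ') (ϖ : Λ → ℝ) (ϖ' : Λ' → ℝ)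
    {C : (Λ → 𝔄) → (Λ' → 𝔅)} (N : Λ' → Λ → Prop)
    (hloc : ∀ A A' : Λ → 𝔄, ∀ c, (∀ b, N c b → A b = A' b) → C A c = C A' c)
    {r₀ : ℝ} (hreach : ∀ c b, N c b → ϖ' c - r₀ ≤ ϖ b)
    {C₂ R ρ : ℝ} (hC₂ : 0 ≤ C₂) (hρ : 0 < ρ) (hρR : 2 * ρ ≤ R)
    (hCq : ∀ Z : Λ → 𝔄, ‖Z‖ < R → ‖C Z‖ ≤ C₂ * ‖Z‖ ^ 2) (hCd : DifferentiableOn ℂ C (ball 0 R)) :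
    ∀ A A' : Λ → 𝔄, ‖A‖ < ρ → ‖A'‖ < ρ →
      ‖((toPiL (pinW δ' ϖ') 1).symm (C A) - (toPiL (pinW δ' ϖ') 1).symm (C A') : WSup (pinW δ' ϖ') 1 𝔅)‖ ≤
        4 * C₂ * ρ * Real.exp (δ' * r₀) *
          ‖((toPiL (pinW δ' ϖ) 1).symm A - (toPiL (pinW δ' ϖ) 1).symm A' : WSup (pinW δ' ϖ) 1 𝔄)‖ :=
  fun _ _ hA hA' => norm_conj_sub_le_of_local hδ' ϖ ϖ' N hloc hreach (by positivity)
    (fun _ _ hZ hZ' => lipschitz_of_quadPair_field hC₂ hCq hCd hρR hZ hZ') hA hA'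

end LocalPair

/-! ## §3 The (P4) letter at the field radius (S81 f2 §2's twins) -/

section P4

variable {Λ Λz : Type*} [Fintype Λ] [Fintype Λz] {𝔄 ℭ : Type*} [NormedAddCommGroup 𝔄] [NormedSpace ℂ 𝔄]
  [NormedAddCommGroup ℭ] [NormedSpace ℂ ℭ]

/-- **`hWp` FROM THE CHAIN's OWN `Prop4Hyp`, AT THE FIELD RADIUS**: `W` local (supports `N`, reach `r_W`), `Prop4Hyp W C₄ a₃` (`0 ≤ C₄`),
a field radius `0 < ρ_W`, `2ρ_W ≤ a₃` ⟹ for all flat `‖Y‖, ‖Y′‖ < ρ_W`: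
`‖Wpin Y − Wpin Y′‖_pin ≤ (4C₄ρ_W·e^{δ′r_W})·‖Y − Y′‖_pin` (S81 f2 `hWp_of_local`: `2C₄a₃·e^{δ′r_W}` on `a₃∕2`). [folklore] -/
theorem hWp_of_local_field {δ' : ℝ} (hδ' : 0 ≤ δ') (ϖ : Λ → ℝ) (ϖz : Λz → ℝ) {W : (Λ → 𝔄) → (Λz → ℭ)}
    (N : Λz → Λ → Prop) (hloc : ∀ A A' : Λ → 𝔄, ∀ c, (∀ b, N c b → A b = A' b) → W A c = W A' c)
    {rW : ℝ} (hreach : ∀ c b, N c b → ϖz c - rW ≤ ϖ b) {C₄ a₃ ρW : ℝ} (hC₄ : 0 ≤ C₄) (hρW : 0 < ρW)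
    (hρa : 2 * ρW ≤ a₃) (hW : Prop4Hyp W C₄ a₃) :
    ∀ Y Y' : Λ → 𝔄, ‖Y‖ < ρW → ‖Y'‖ < ρW →
      ‖((toPiL (pinW δ' ϖz) 1).symm (W Y) - (toPiL (pinW δ' ϖz) 1).symm (W Y') : WSup (pinW δ' ϖz) 1 ℭ)‖ ≤
        4 * C₄ * ρW * Real.exp (δ' * rW) *
          ‖((toPiL (pinW δ' ϖ) 1).symm Y - (toPiL (pinW δ' ϖ) 1).symm Y' : WSup (pinW δ' ϖ) 1 𝔄)‖ := by
  have hWd : DifferentiableOn ℂ W (ball 0 a₃) := by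
    have e : ball (0 : Λ → 𝔄) a₃ = {Y | ‖Y‖ < a₃} := by
      ext Y
      simp
    rw [e]
    exact hW.differentiableOn
  exact hCp_of_local_field hδ' ϖ ϖz N hloc hreach hC₄ hρW hρa hW.quad hWd

variable {P𝒴 P𝒵 : Type*}

/-- **`hGWp` AT THE FIELD RADIUS**: the propagator as `kerOp k𝒢` with a bound `B_𝒢p` on its S69 conjugate, the (P4) letter local
with reach `r_W` and `Prop4Hyp W C₄ a₃`, the chain's ball `ε` with `2ε ≤ a₃` ((121)) ⟹ `hGWp` on the flat ball `ε` with
**`q_W♯ = B_𝒢p·(4C₄ε·e^{δ′r_W})`** — the (P4) map's FIELD-SIZE contraction factor ((158)'s `4B₀C₄(ε₄+a)` with the pinned propagator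
constant in the place of `B₀`). [folklore] -/
theorem hGWp_of_local_field {δ' : ℝ} (hδ' : 0 ≤ δ') (ϖ : Λ → ℝ) (ϖz : Λz → ℝ) (k𝒢 : Λ → Λz → (ℭ →L[ℂ] 𝔄)) {B𝒢p : ℝ}
    (hB𝒢p : 0 ≤ B𝒢p) (h𝒢p : ‖kerOpPin k𝒢 δ' ϖz ϖ‖ ≤ B𝒢p) {W : (Λ → 𝔄) → (Λz → ℭ)}
    (N : Λz → Λ → Prop) (hloc : ∀ A A' : Λ → 𝔄, ∀ c, (∀ b, N c b → A b = A' b) → W A c = W A' c)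
    {rW : ℝ} (hreach : ∀ c b, N c b → ϖz c - rW ≤ ϖ b) {C₄ a₃ ε : ℝ} (hC₄ : 0 ≤ C₄) (hε : 2 * ε ≤ a₃) (hε0 : 0 < ε)
    (hW : Prop4Hyp W C₄ a₃) :
    ∀ Y Y' : Λ → 𝔄, ‖Y‖ < ε → ‖Y'‖ < ε →
      ‖((toPiL (pinW δ' ϖ) 1).symm (kerOp k𝒢 (W Y)) - (toPiL (pinW δ' ϖ) 1).symm (kerOp k𝒢 (W Y')) :
          WSup (pinW δ' ϖ) 1 𝔄)‖ ≤
        B𝒢p * (4 * C₄ * ε * Real.exp (δ' * rW)) *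
          ‖((toPiL (pinW δ' ϖ) 1).symm Y - (toPiL (pinW δ' ϖ) 1).symm Y' : WSup (pinW δ' ϖ) 1 𝔄)‖ := by
  have hWp := hWp_of_local_field hδ' ϖ ϖz N hloc hreach hC₄ hε0 hε hW
  have h := hGWp_of_pinnedLipschitz (𝒢 := kerOp k𝒢) (W := W) (ε := ε)
    (toPiL (𝔄 := 𝔄) (pinW δ' ϖ) 1).symm.toContinuousLinearMap
    (toPiL (𝔄 := ℭ) (pinW δ' ϖz) 1).symm.toContinuousLinearMap hB𝒢p
    (fun f => by simpa only [ContinuousLinearEquiv.coe_coe] using norm_conj_kerOp_le k𝒢 δ' ϖz ϖ h𝒢p f)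
    (fun Y Y' hY hY' => by simpa only [ContinuousLinearEquiv.coe_coe] using hWp Y Y' hY hY')
  intro Y Y' hY hY'
  simpa only [ContinuousLinearEquiv.coe_coe] using h Y Y' hY hY'

end P4

/-! ## §4 S81 f1 §5's junction with Sect. C RUN AT THE FIELD RADIUS `3(ε₄ + B₀b)` — the budget `k♯` -/

section Junction

variable {Λ Λ' : Type*} [Fintype Λ] [Fintype Λ'] {𝔄 𝔅 : Type*} [NormedAddCommGroup 𝔄] [NormedSpace ℂ 𝔄]
  [NormedAddCommGroup 𝔅] [NormedSpace ℂ 𝔅] [CompleteSpace 𝔅]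
variable {𝒴 𝒵 ℬ P𝒴 P𝒵 Pℬ : Type*} [NormedAddCommGroup 𝒴] [NormedSpace ℂ 𝒴] [CompleteSpace 𝒴]
  [NormedAddCommGroup 𝒵] [NormedSpace ℂ 𝒵] [NormedAddCommGroup ℬ] [NormedSpace ℂ ℬ]
  [NormedAddCommGroup P𝒴] [NormedSpace ℂ P𝒴] [NormedAddCommGroup P𝒵] [NormedSpace ℂ P𝒵]
  [NormedAddCommGroup Pℬ] [NormedSpace ℂ Pℬ]

/-- **S70 (iv) WITH `hCp` AT THE FIELD RADIUS — THE LANDAU BUDGET IN (53)–(54)'s SHAPE.**  S81 f1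
`norm_sub_landauField_chart_le_of_local`'s data VERBATIM (`𝒴′ := Λ → 𝔄`, `𝒳 := Λ′ → 𝔅` flat; (P2) `h𝒢`, (P4) `hW`, (118)∕(121) at
`a = B₀b`, (103) `hH₁`, (75)-TYPE `hΦ` with `Φ 0 = 0`, (44) `hCq`∕`hCd` at radius `R` with `hRC : 6(ε₄ + B₀b) ≤ R`, scaling `hι`, (46) `hH`,
(54) `hq`; the (44) letter's located supports `N` with reach `r₀`; the `W`-slot `B_𝒢p`, `L_W`, `B_𝒢p·L_W < 1`; `hιp hHp hH₁p hΦp`) EXCEPT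
the Landau budget, which here is **`hk : 12·C₂·(ε₄ + B₀b)·e^{δ′r₀}·c_ι·B_H < 1`** — Sect. C run at the FIELD radius `3(ε₄ + B₀b)`
(S70 f2 `norm_sub_landauField_chart_le` at `R := 3(ε₄+B₀b)`), the (44) letter's pinned Lipschitz constant from §2 at `ρ := 3(ε₄+B₀b)`
(`2ρ ≤ R` is `hRC`).  CONCLUSION: the exponent field's pinned variation and size are `≤ z_pin`,
**`z_pin = B₁ₚbₚ∕((1 − B_𝒢p·L_W)(1 − 12C₂(ε₄+B₀b)e^{δ′r₀}·c_ι·B_H))`**.  Nothing printed is asserted; NE7c NOT PROVED. [folklore] -/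
theorem norm_sub_landauField_chart_le_of_local_field {m₀ : ℕ} (π𝒴 : 𝒴 →L[ℂ] P𝒴) (π𝒵 : 𝒵 →L[ℂ] P𝒵)
    (πℬ : ℬ →L[ℂ] Pℬ) {δ' : ℝ} (hδ' : 0 ≤ δ') (ϖ : Λ → ℝ) (ϖ' : Λ' → ℝ)
    {𝒢 : 𝒵 →L[ℂ] 𝒴} {W : 𝒴 → 𝒵} {B₀ C₄ a₃ ε₄ b : ℝ}
    {C : (Λ → 𝔄) → (Λ' → 𝔅)} {ι : 𝒴 →L[ℂ] (Λ → 𝔄)} {H : (Λ' → 𝔅) →L[ℂ] 𝒴} {C₂ R cι BH : ℝ}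
    {H₁ : ℬ →L[ℂ] 𝒴} {Φ : (Fin m₀ → ℂ) → ℬ} {rΦ B₁p bp B𝒢p LW : ℝ}
    -- the flat lists
    (h𝒢 : ∀ f, ‖𝒢 f‖ ≤ B₀ * ‖f‖) (hW : Prop4Hyp W C₄ a₃) (hB₀ : 0 < B₀) (hC₄ : 0 ≤ C₄) (hε₄ : 0 ≤ ε₄)
    (hdom : 2 * (ε₄ + B₀ * b) ≤ a₃) (hself : B₀ * C₄ * (ε₄ + B₀ * b) ^ 2 ≤ ε₄)
    (hcontr : 4 * B₀ * C₄ * (ε₄ + B₀ * b) < 1)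
    (hH₁ : ∀ B, ‖H₁ B‖ ≤ B₀ * ‖B‖) (hΦ0 : Φ 0 = 0) (hΦ : ∀ z ∈ ball (0 : Fin m₀ → ℂ) rΦ, ‖Φ z‖ < b)
    (hC₂ : 0 ≤ C₂) (hCq : ∀ Z : Λ → 𝔄, ‖Z‖ < R → ‖C Z‖ ≤ C₂ * ‖Z‖ ^ 2) (hCd : DifferentiableOn ℂ C (ball 0 R))
    (hι : ∀ Y, ‖ι Y‖ ≤ ‖Y‖) (hH : ∀ X, ‖H X‖ ≤ B₀ * ‖X‖) (hq : 9 * C₂ * B₀ * (ε₄ + B₀ * b) < 1)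
    (hRC : 6 * (ε₄ + B₀ * b) ≤ R)
    -- the (44) letter's locality and the reach of the pins (in place of `hCp`)
    (N : Λ' → Λ → Prop) (hloc : ∀ A A' : Λ → 𝔄, ∀ c, (∀ b', N c b' → A b' = A' b') → C A c = C A' c)
    {r₀ : ℝ} (hreach : ∀ c b', N c b' → ϖ' c - r₀ ≤ ϖ b')
    -- the `W`-slot (in place of `hGWp`)
    (hB𝒢p : 0 ≤ B𝒢p) (h𝒢p : ∀ f, ‖π𝒴 (𝒢 f)‖ ≤ B𝒢p * ‖π𝒵 f‖)
    (hWp : ∀ Y Y', ‖Y‖ < ε₄ + B₀ * b → ‖Y'‖ < ε₄ + B₀ * b → ‖π𝒵 (W Y) - π𝒵 (W Y')‖ ≤ LW * ‖π𝒴 Y - π𝒴 Y'‖)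
    (hqW : B𝒢p * LW < 1)
    -- the remaining pinned binders (linear letters; the block-supported coarse field)
    (hιp : ∀ Y, ‖((toPiL (pinW δ' ϖ) 1).symm (ι Y) : WSup (pinW δ' ϖ) 1 𝔄)‖ ≤ cι * ‖π𝒴 Y‖)
    (hHp : ∀ X, ‖π𝒴 (H X)‖ ≤ BH * ‖((toPiL (pinW δ' ϖ') 1).symm X : WSup (pinW δ' ϖ') 1 𝔅)‖)
    (hcι : 0 ≤ cι) (hBH : 0 ≤ BH)
    -- ══ THE LANDAU BUDGET IN THE FIELD-SIZE SHAPE ══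
    (hk : 12 * C₂ * (ε₄ + B₀ * b) * Real.exp (δ' * r₀) * cι * BH < 1)
    (hB₁p : 0 ≤ B₁p) (hH₁p : ∀ B, ‖π𝒴 (H₁ B)‖ ≤ B₁p * ‖πℬ B‖)
    (hΦp : ∀ z ∈ ball (0 : Fin m₀ → ℂ) rΦ, ‖πℬ (Φ z)‖ ≤ bp) {z : Fin m₀ → ℂ} (hz : z ∈ ball (0 : Fin m₀ → ℂ) rΦ) :
    ‖π𝒴 (landauExp C ι H (4 * C₂ * (ε₄ + B₀ * b) ^ 2) (solAt 𝒢 0 W ε₄ (0 : 𝒵) (H₁ (Φ z)) + H₁ (Φ z))) -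
        π𝒴 (landauExp C ι H (4 * C₂ * (ε₄ + B₀ * b) ^ 2) (solAt 𝒢 0 W ε₄ (0 : 𝒵) (H₁ (Φ 0)) + H₁ (Φ 0)))‖ ≤
      B₁p * bp / ((1 - B𝒢p * LW) * (1 - 12 * C₂ * (ε₄ + B₀ * b) * Real.exp (δ' * r₀) * cι * BH)) ∧
    ‖π𝒴 (landauExp C ι H (4 * C₂ * (ε₄ + B₀ * b) ^ 2) (solAt 𝒢 0 W ε₄ (0 : 𝒵) (H₁ (Φ z)) + H₁ (Φ z)))‖ ≤
      B₁p * bp / ((1 - B𝒢p * LW) * (1 - 12 * C₂ * (ε₄ + B₀ * b) * Real.exp (δ' * r₀) * cι * BH)) := by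
  have hε : 0 < ε₄ + B₀ * b := by
    have hrΦ : 0 < rΦ := (norm_nonneg z).trans_lt (mem_ball_zero_iff.1 hz)
    have hb : 0 < b := by have h := hΦ 0 (mem_ball_self hrΦ); rwa [hΦ0, norm_zero] at h
    exact add_pos_of_nonneg_of_pos hε₄ (mul_pos hB₀ hb)
  -- Sect. C's flat list at the FIELD radius `ρ := 3(ε₄ + B₀b)` (`2ρ ≤ R` is `hRC`)
  set ρ : ℝ := 3 * (ε₄ + B₀ * b) with hρ
  have hρ0 : 0 < ρ := by rw [hρ]; positivity
  have hρR : 2 * ρ ≤ R := by rw [hρ]; linarith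
  have hCq' : ∀ Z : Λ → 𝔄, ‖Z‖ < ρ → ‖C Z‖ ≤ C₂ * ‖Z‖ ^ 2 := fun Z hZ => hCq Z (hZ.trans_le (by linarith))
  have hCd' : DifferentiableOn ℂ C (ball 0 ρ) := hCd.mono (ball_subset_ball (by linarith))
  have hRC' : 3 * (ε₄ + B₀ * b) ≤ ρ := le_of_eq hρ.symm
  -- the two inhabited binders, read through the readings as continuous linear maps
  have hCp := hCp_of_local_field hδ' ϖ ϖ' N hloc hreach hC₂ hρ0 hρR hCq hCd
  have hGWp := hGWp_of_pinnedLipschitz π𝒴 π𝒵 hB𝒢p h𝒢p hWp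
  have hLC : 4 * C₂ * ρ * Real.exp (δ' * r₀) = 12 * C₂ * (ε₄ + B₀ * b) * Real.exp (δ' * r₀) := by rw [hρ]; ring
  have hk' : 4 * C₂ * ρ * Real.exp (δ' * r₀) * cι * BH < 1 := by rw [hLC]; exact hk
  have h := norm_sub_landauField_chart_le π𝒴 (toPiL (𝔄 := 𝔄) (pinW δ' ϖ) 1).symm.toContinuousLinearMap
    (toPiL (𝔄 := 𝔅) (pinW δ' ϖ') 1).symm.toContinuousLinearMap πℬ h𝒢 hW hB₀ hC₄ hε₄ hdom hself hcontr
    hH₁ hΦ0 hΦ hC₂ hCq' hCd' hι hH hq hRC' hGWp hqW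
    (fun A A' hA hA' => by simpa only [ContinuousLinearEquiv.coe_coe] using hCp A A' hA hA')
    (fun Y => by simpa only [ContinuousLinearEquiv.coe_coe] using hιp Y)
    (fun X => by simpa only [ContinuousLinearEquiv.coe_coe] using hHp X)
    (by positivity) hcι hBH hk' hB₁p hH₁p hΦp hz
  rw [hLC] at h
  exact h

end Junction

/-! ## §5 S81 f2 §4's END with BOTH budgets in the field-size shape — `z_pin♯` -/

section End

variable {Λ Λz Λ' Λx Λb : Type*} [Fintype Λ] [Fintype Λz] [Fintype Λ'] [Fintype Λx] [Fintype Λb]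
variable {𝔄 ℭ 𝔄' 𝔅 𝔇 : Type*} [NormedAddCommGroup 𝔄] [NormedSpace ℂ 𝔄] [CompleteSpace 𝔄]
  [NormedAddCommGroup ℭ] [NormedSpace ℂ ℭ] [NormedAddCommGroup 𝔄'] [NormedSpace ℂ 𝔄']
  [NormedAddCommGroup 𝔅] [NormedSpace ℂ 𝔅] [CompleteSpace 𝔅] [NormedAddCommGroup 𝔇] [NormedSpace ℂ 𝔇]

/-- **S70 (iv) WITH EVERY PINNED BINDER INHABITED AND BOTH CONTRACTION NUMBERS IN PRINT's FIELD-SIZE SHAPE.**  S81 f2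
`norm_sub_landauField_chart_le_of_kernels`' data VERBATIM (five FLAT pi-types, readings `(toPiL (pinW δ′ ϖ·) 1).symm`, the flat lists
(P2)∕(P4)∕(118)∕(121)∕(103)∕(75)-TYPE∕(44) at radius `R`∕scaling∕(46)∕(54) with `hRC : 6(ε₄ + B₀b) ≤ R`, the four linear letters as
`kerOp`s with pinned bounds `B_𝒢p`, `c_ι`, `B_H`, `B₁ₚ`, the (P4) and (44) letters LOCAL with reaches `r_W`, `r_C`, the block support)
EXCEPT the two budgets, which here are **`hqW : B_𝒢p·(4·C₄·(ε₄ + B₀b)·e^{δ′r_W}) < 1`** ((121)∕(158): the (P4) ball IS `ε₄ + B₀b`,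
`hdom` is `2ρ_W ≤ a₃`) and **`hk : 12·C₂·(ε₄ + B₀b)·e^{δ′r_C}·c_ι·B_H < 1`** ((54): Sect. C at `3(ε₄ + B₀b)`).  CONCLUSION, for
`Z_V z = landauExp C ι H (4C₂(ε₄+B₀b)²) (solAt 𝒢 0 W ε₄ 0 (H₁ (Φ z)) + H₁ (Φ z))` and every `z` in the chart ball:
`‖π (Z_V z) − π (Z_V 0)‖_pin ≤ z_pin♯`, `‖π (Z_V z)‖_pin ≤ z_pin♯`,
**`z_pin♯ = B₁ₚ·b∕((1 − B_𝒢p·(4C₄(ε₄+B₀b)e^{δ′r_W}))(1 − 12C₂(ε₄+B₀b)e^{δ′r_C}·c_ι·B_H))`**.  Nothing printed is asserted; no estimate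
of Bałaban's discharged; NE7c NOT PROVED. [folklore] -/
theorem norm_sub_landauField_chart_le_of_kernels_field {m₀ : ℕ} {δ' : ℝ} (hδ' : 0 ≤ δ')
    (ϖ : Λ → ℝ) (ϖz : Λz → ℝ) (ϖ' : Λ' → ℝ) (ϖx : Λx → ℝ) (ϖb : Λb → ℝ)
    (k𝒢 : Λ → Λz → (ℭ →L[ℂ] 𝔄)) (kι : Λ' → Λ → (𝔄 →L[ℂ] 𝔄')) (kH : Λ → Λx → (𝔅 →L[ℂ] 𝔄))
    (kH₁ : Λ → Λb → (𝔇 →L[ℂ] 𝔄)) {B𝒢p cι BH B₁p : ℝ} (hB𝒢p : 0 ≤ B𝒢p) (hcι : 0 ≤ cι) (hBH : 0 ≤ BH)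
    (hB₁p : 0 ≤ B₁p) (h𝒢p : ‖kerOpPin k𝒢 δ' ϖz ϖ‖ ≤ B𝒢p) (hιp : ‖kerOpPin kι δ' ϖ ϖ'‖ ≤ cι)
    (hHp : ‖kerOpPin kH δ' ϖx ϖ‖ ≤ BH) (hH₁p : ‖kerOpPin kH₁ δ' ϖb ϖ‖ ≤ B₁p)
    {W : (Λ → 𝔄) → (Λz → ℭ)} {B₀ C₄ a₃ ε₄ b : ℝ} {C : (Λ' → 𝔄') → (Λx → 𝔅)} {C₂ R : ℝ}
    {Φ : (Fin m₀ → ℂ) → (Λb → 𝔇)} {rΦ : ℝ}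
    (h𝒢 : ∀ f, ‖kerOp k𝒢 f‖ ≤ B₀ * ‖f‖) (hW : Prop4Hyp W C₄ a₃) (hB₀ : 0 < B₀) (hC₄ : 0 ≤ C₄) (hε₄ : 0 ≤ ε₄)
    (hdom : 2 * (ε₄ + B₀ * b) ≤ a₃) (hself : B₀ * C₄ * (ε₄ + B₀ * b) ^ 2 ≤ ε₄)
    (hcontr : 4 * B₀ * C₄ * (ε₄ + B₀ * b) < 1)
    (hH₁ : ∀ B, ‖kerOp kH₁ B‖ ≤ B₀ * ‖B‖) (hΦ0 : Φ 0 = 0) (hΦ : ∀ z ∈ ball (0 : Fin m₀ → ℂ) rΦ, ‖Φ z‖ < b)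
    (hC₂ : 0 ≤ C₂) (hCq : ∀ Z : Λ' → 𝔄', ‖Z‖ < R → ‖C Z‖ ≤ C₂ * ‖Z‖ ^ 2) (hCd : DifferentiableOn ℂ C (ball 0 R))
    (hι : ∀ Y, ‖kerOp kι Y‖ ≤ ‖Y‖) (hH : ∀ X, ‖kerOp kH X‖ ≤ B₀ * ‖X‖) (hq : 9 * C₂ * B₀ * (ε₄ + B₀ * b) < 1)
    (hRC : 6 * (ε₄ + B₀ * b) ≤ R)
    (NW : Λz → Λ → Prop) (hlocW : ∀ A A' : Λ → 𝔄, ∀ c, (∀ b', NW c b' → A b' = A' b') → W A c = W A' c)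
    {rW : ℝ} (hreachW : ∀ c b', NW c b' → ϖz c - rW ≤ ϖ b')
    (NC : Λx → Λ' → Prop) (hlocC : ∀ A A' : Λ' → 𝔄', ∀ c, (∀ b', NC c b' → A b' = A' b') → C A c = C A' c)
    {rC : ℝ} (hreachC : ∀ c b', NC c b' → ϖx c - rC ≤ ϖ' b')
    (hsupp : ∀ z : Fin m₀ → ℂ, ∀ i, 0 < ϖb i → Φ z i = 0)
    -- ══ THE TWO CONTRACTION NUMBERS IN THE FIELD-SIZE SHAPE ((158) ∕ (53)–(54)) ══
    (hqW : B𝒢p * (4 * C₄ * (ε₄ + B₀ * b) * Real.exp (δ' * rW)) < 1)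
    (hk : 12 * C₂ * (ε₄ + B₀ * b) * Real.exp (δ' * rC) * cι * BH < 1)
    {z : Fin m₀ → ℂ} (hz : z ∈ ball (0 : Fin m₀ → ℂ) rΦ) :
    ‖((toPiL (pinW δ' ϖ) 1).symm (landauExp C (kerOp kι) (kerOp kH) (4 * C₂ * (ε₄ + B₀ * b) ^ 2)
          (solAt (kerOp k𝒢) 0 W ε₄ (0 : Λz → ℭ) (kerOp kH₁ (Φ z)) + kerOp kH₁ (Φ z))) -
        (toPiL (pinW δ' ϖ) 1).symm (landauExp C (kerOp kι) (kerOp kH) (4 * C₂ * (ε₄ + B₀ * b) ^ 2)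
          (solAt (kerOp k𝒢) 0 W ε₄ (0 : Λz → ℭ) (kerOp kH₁ (Φ 0)) + kerOp kH₁ (Φ 0))) : WSup (pinW δ' ϖ) 1 𝔄)‖ ≤
      B₁p * b / ((1 - B𝒢p * (4 * C₄ * (ε₄ + B₀ * b) * Real.exp (δ' * rW))) *
        (1 - 12 * C₂ * (ε₄ + B₀ * b) * Real.exp (δ' * rC) * cι * BH)) ∧
    ‖((toPiL (pinW δ' ϖ) 1).symm (landauExp C (kerOp kι) (kerOp kH) (4 * C₂ * (ε₄ + B₀ * b) ^ 2)
          (solAt (kerOp k𝒢) 0 W ε₄ (0 : Λz → ℭ) (kerOp kH₁ (Φ z)) + kerOp kH₁ (Φ z))) : WSup (pinW δ' ϖ) 1 𝔄)‖ ≤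
      B₁p * b / ((1 - B𝒢p * (4 * C₄ * (ε₄ + B₀ * b) * Real.exp (δ' * rW))) *
        (1 - 12 * C₂ * (ε₄ + B₀ * b) * Real.exp (δ' * rC) * cι * BH)) := by
  have hrΦ : 0 < rΦ := (norm_nonneg z).trans_lt (mem_ball_zero_iff.1 hz)
  have hb : 0 < b := by have h := hΦ 0 (mem_ball_self hrΦ); rwa [hΦ0, norm_zero] at h
  have hε : 0 < ε₄ + B₀ * b := add_pos_of_nonneg_of_pos hε₄ (mul_pos hB₀ hb)
  -- the `W`-slot AT THE FIELD RADIUS `ε₄ + B₀b` (§3; `hdom` is `2ρ_W ≤ a₃`)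
  have hWp := hWp_of_local_field hδ' ϖ ϖz NW hlocW hreachW hC₄ hε hdom hW
  have h := norm_sub_landauField_chart_le_of_local_field (𝒢 := kerOp k𝒢) (W := W) (H₁ := kerOp kH₁) (ι := kerOp kι)
    (H := kerOp kH) (toPiL (𝔄 := 𝔄) (pinW δ' ϖ) 1).symm.toContinuousLinearMap
    (toPiL (𝔄 := ℭ) (pinW δ' ϖz) 1).symm.toContinuousLinearMap
    (toPiL (𝔄 := 𝔇) (pinW δ' ϖb) 1).symm.toContinuousLinearMap hδ' ϖ' ϖx h𝒢 hW hB₀ hC₄ hε₄ hdom hself hcontr hH₁ hΦ0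
    hΦ hC₂ hCq hCd hι hH hq hRC NC hlocC hreachC hB𝒢p
    (fun f => by simpa only [ContinuousLinearEquiv.coe_coe] using norm_conj_kerOp_le k𝒢 δ' ϖz ϖ h𝒢p f)
    (fun Y Y' hY hY' => by simpa only [ContinuousLinearEquiv.coe_coe] using hWp Y Y' hY hY')
    hqW (fun Y => norm_conj_kerOp_le kι δ' ϖ ϖ' hιp Y)
    (fun X => by simpa only [ContinuousLinearEquiv.coe_coe] using norm_conj_kerOp_le kH δ' ϖx ϖ hHp X)
    hcι hBH hk hB₁p
    (fun B => by simpa only [ContinuousLinearEquiv.coe_coe] using norm_conj_kerOp_le kH₁ δ' ϖb ϖ hH₁p B)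
    (fun z' hz' => by
      simpa only [ContinuousLinearEquiv.coe_coe] using hΦp_of_support hδ' ϖb hsupp hΦ z' hz') hz
  simpa only [ContinuousLinearEquiv.coe_coe] using h

end End

end Summit.QuantumFields.BalabanUV.T4Continuum.ShellMeasureLandauPinnedFieldRadius

end
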